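/-
Origin: expansion seat `planner-pub-hodgecm-qw8-g6-0`, handover #2 v2 2026-08-18T08:56:53Z (`HOME/pub-hodgecm-qw8-g6/lean/Qw8g6/LefWitnessF7d.lean`, md5 63d3ac46, 151 lines);
landed by the gen-7 packager in gate run 27 as `HodgeCM/Model/Toy/LefWitnessF7d.lean` (import ^import Qw8g6\.→import HodgeCM.Model.Toy. ×1).
-/
-- HANDOVER (planner-pub-hodgecm-qw8-g6-0, unit pub-hodgecm-qw8-g6): WIP module `Qw8g6.LefWitnessF7d`; intended final module
-- `HodgeCM.Model.Toy.LefWitnessF7d` (kind L5, separating model); rename `import Qw8g6.X` ↦ `import HodgeCM.Model.Toy.X`.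
/-
Copyright: pub-hodgecm cell (HodgeCMPerL). Separating-model layer (gen 6 of the [QW8] §2.5 lineage). New file (additive leaf).

# The Lefschetz model also satisfies the TRACE-FREE Gysin descent F7d — separation for `COR_CM_of_descentFacts`

`LefWitness` separates the hypothesis list of the run-25 assembly `Assembly.COR_CM_of_descentFactsB` (F-H0 + F7d-B).
The run-24 assembly `Assembly.COR_CM_of_descentFacts` (`StubTree/Qw8GysinDescent.lean`) uses instead the full
trace-free descent fact F7d `Universe.Fact_gysinDescent` = (a) injectivity of `e ↦ p_Y^* e ∪ p_{Y'}^* ω` (all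
degrees) ∧ (b) descent of algebraicity.  Clause (a) does not mention `alg`, so it transfers to `U.balMod B C`
verbatim; clause (b) transfers exactly as F7d-B (`Universe.Fact_gysinDescentB.balMod`).  Hence `lefModel` satisfies
F7d as well (`lef_gysinDescent`, from the landed `HodgeCM.Toy.fact_gysinDescent` and `bal_descentB`), and the binders
of `COR_CM_of_descentFacts` other than the realisation input do not imply COR-CM either
(`descentFacts_not_sufficient`); `descentFactsAll_not_sufficient` records both lists at once (eleven generic facts).

Read through the TOP assembly `Assembly.COR_CM (M) (hR : RealisationExistsFace) (hP : PohlmannSpan)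
(hQ : Qw8Sufficiency) = hc_cm_of (w_rk4 M hR) (faceReduction_holds hP hQ) (lemma81_holds M)`: in `lefModel` the two
REDUCTION inputs hold — `PohlmannSpan` (`Universe.pohlmannSpan_of_facts`) and `Qw8Sufficiency`
(`Universe.qw8Sufficiency_of_descentFacts`) — hence `FaceReduction` and `Lemma81` hold, while `W_RK4` (rfwf Thm 1.3:
the face Weil lines are algebraic), `HC_CM` and `RealisationExistsFace` fail: `reductionInputs_not_sufficient`,
`not_cor_cm_of_reductionInputs : ¬ ∀ U, ModelAxioms → PohlmannSpan → Qw8Sufficiency → HC_CM`.  So the model facts and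
BOTH reduction inputs of COR-CM are jointly consistent with ¬COR-CM; all remaining content of `Assembly.COR_CM` is in
the branch `RealisationExistsFace ⟹ W_RK4` (complementing the landed `Model/NonVacuity.lean`, which separates the
realisation input from the others only under a consistency hypothesis and leaves `HC_CM` on the positive side).

Main declarations
* `HodgeCM.Universe.Fact_gysinDescent.balMod` — generic transfer of F7d to `U.balMod B C` under `BalDescentB`.
* `HodgeCM.Toy.lef_gysinDescent`, `HodgeCM.Toy.descentFacts_not_sufficient`,
  `HodgeCM.Toy.descentFactsAll_not_sufficient`.
* `HodgeCM.Toy.lef_pohlmannSpan`, `HodgeCM.Toy.lef_qw8Sufficiency`, `HodgeCM.Toy.lef_faceReduction`,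
  `HodgeCM.Toy.lef_lemma81`, `HodgeCM.Toy.not_w_rk4_lefModel`, `HodgeCM.Toy.reductionInputs_not_sufficient`,
  `HodgeCM.Toy.not_cor_cm_of_reductionInputs`.
-/
import Mathlib
import Summits.HodgeConjecture.HodgeCM.Model.Toy.LefWitness

/-! PORT of `HodgeCM/Model/Toy/LefWitnessF7d.lean` (HodgeCMPerL run 82) — verbatim mechanical port; provenance in the PORT header line. -/

noncomputable section

open scoped TensorProduct

namespace HodgeCM

open Literature.AlgebraicGeometry.Motives (CMType)

namespace Universe

variable {U : Universe} {B : (X : U.Var) → (p : ℕ) → Submodule ℚ (U.Coh X (2 * p))} {C : U.Var → Prop}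

set_option smartUnfolding false in
/-- **F7d for `U.balMod B C`**: clause (a) is the same statement (cup / pull / `cmProd` are unchanged), clause (b)
from F7d (b) for `U` and the `B`-descent `BalDescentB`. -/
theorem Fact_gysinDescent.balMod (h : U.Fact_gysinDescent) (hB : U.BalDescentB B) :
    (U.balMod B C).Fact_gysinDescent := by
  intro F n m Ξ pA pB hP ω hω
  refine ⟨fun k e he => (h F n m Ξ pA pB hP ω hω).1 k e he, fun p e he => ?_⟩
  have he' : U.castCoh (U.cmProd F Ξ)
      (by omega : 2 * p + 2 * U.dim (U.cmProd F (blkB Ξ)) = 2 * (p + U.dim (U.cmProd F (blkB Ξ))))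
      (U.cup (U.cmProd F Ξ) (2 * p) _ (U.pull pA (2 * p) e) (U.pull pB _ ω)) ∈
        U.alg (U.cmProd F Ξ) (p + U.dim (U.cmProd F (blkB Ξ))) ⊓ B (U.cmProd F Ξ) (p + U.dim (U.cmProd F (blkB Ξ))) :=
    he
  exact Submodule.mem_inf.mpr
    ⟨(h F n m Ξ pA pB hP ω hω).2 p e (Submodule.mem_inf.mp he').1,
      hB F n m Ξ pA pB hP ω hω p e (Submodule.mem_inf.mp he').2⟩

end Universe

namespace Toy

/-- **F7d `Fact_gysinDescent` holds in the Lefschetz model.** -/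
theorem lef_gysinDescent : lefModel.Fact_gysinDescent :=
  Universe.Fact_gysinDescent.balMod fact_gysinDescent bal_descentB

/-- the realisation input fails in `lefModel` — this time read off the run-24 assembly `COR_CM_of_descentFacts`
(same conclusion as `not_realisationExistsFace_lefModel`, recorded to show that assembly's other binders all hold). -/
theorem not_realisationExistsFace_lefModel' : ¬ lefModel.RealisationExistsFace := fun hR =>
  not_hc_cm_lefModel (Assembly.COR_CM_of_descentFacts lefModel lefModel_modelAxioms hR lef_cupExterior
    lef_cup_hodge lef_pull_H0 lef_hodge_F0 lef_cupAlg lef_cupAssoc lef_gysinDescent lef_dimProd)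

/-- **HEADLINE (separation, trace-free F7d list).** The binders of `Assembly.COR_CM_of_descentFacts` other than the
realisation input — `ModelAxioms`, N1–N4, F4 `Fact_cupAlg`, F5 `Fact_cupAssoc`, F7d `Fact_gysinDescent`,
`Fact_dimProd` (the list shown jointly consistent by `HodgeCM.Toy.descentFacts_consistent`) — do NOT imply COR-CM. -/
theorem descentFacts_not_sufficient :
    ∃ U : Universe, U.ModelAxioms ∧ U.Fact_cupExterior ∧ U.Fact_cup_hodge ∧ U.Fact_pull_H0 ∧ U.Fact_hodge_F0 ∧
      U.Fact_cupAlg ∧ U.Fact_cupAssoc ∧ U.Fact_gysinDescent ∧ U.Fact_dimProd ∧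
      ¬ U.HC_CM ∧ ¬ U.RealisationExistsFace ∧ ∃ (K : CMField) (f : Face K), ¬ U.WeilFaceAlgebraic K f :=
  ⟨lefModel, lefModel_modelAxioms, lef_cupExterior, lef_cup_hodge, lef_pull_H0, lef_hodge_F0, lef_cupAlg,
    lef_cupAssoc, lef_gysinDescent, lef_dimProd, not_hc_cm_lefModel, not_realisationExistsFace_lefModel, cyclo7, f7,
    not_weilFaceAlgebraic_f7_lefModel⟩

/-- **HEADLINE (separation, union of both lists).** `ModelAxioms` together with ALL ELEVEN generic facts of the two
[QW8]-side assemblies — N1 `Fact_cupExterior`, N2 `Fact_cup_hodge`, N3 `Fact_pull_H0`, N4 `Fact_hodge_F0`,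
F4 `Fact_cupAlg`, F5 `Fact_cupAssoc`, F-H0 `Fact_unitH0`, F7d-B `Fact_gysinDescentB`, F7d `Fact_gysinDescent`,
`Fact_dimProd` — hold in ONE universe in which COR-CM, the face realisation and the algebraicity of a face Weil line
all fail.  The realisation input is load-bearing in every assembly of the cell's [QW8] side. -/
theorem descentFactsAll_not_sufficient :
    ∃ U : Universe, U.ModelAxioms ∧ U.Fact_cupExterior ∧ U.Fact_cup_hodge ∧ U.Fact_pull_H0 ∧ U.Fact_hodge_F0 ∧
      U.Fact_cupAlg ∧ U.Fact_cupAssoc ∧ U.Fact_unitH0 ∧ U.Fact_gysinDescentB ∧ U.Fact_gysinDescent ∧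
      U.Fact_dimProd ∧
      ¬ U.HC_CM ∧ ¬ U.RealisationExistsFace ∧ ∃ (K : CMField) (f : Face K), ¬ U.WeilFaceAlgebraic K f :=
  ⟨lefModel, lefModel_modelAxioms, lef_cupExterior, lef_cup_hodge, lef_pull_H0, lef_hodge_F0, lef_cupAlg,
    lef_cupAssoc, lef_unitH0, lef_gysinDescentB, lef_gysinDescent, lef_dimProd, not_hc_cm_lefModel,
    not_realisationExistsFace_lefModel, cyclo7, f7, not_weilFaceAlgebraic_f7_lefModel⟩

/-! ### The top assembly `Assembly.COR_CM`: both reduction inputs hold in `lefModel` -/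

/-- Pohlmann's span statement holds in the Lefschetz model (it follows from `ModelAxioms` + N1–N4). -/
theorem lef_pohlmannSpan : lefModel.PohlmannSpan :=
  Universe.pohlmannSpan_of_facts lefModel_modelAxioms lef_cupExterior lef_cup_hodge lef_pull_H0 lef_hodge_F0

/-- `Qw8Sufficiency` ([QW8] Thm 2.5, as REDUCED by the qw8 lineage to the descent facts) holds in the Lefschetz model. -/
theorem lef_qw8Sufficiency : lefModel.Qw8Sufficiency :=
  Universe.qw8Sufficiency_of_descentFacts lefModel_modelAxioms lef_cupExterior lef_cup_hodge lef_pull_H0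
    lef_hodge_F0 lef_cupAlg lef_cupAssoc lef_gysinDescent lef_dimProd

/-- the face reduction holds in the Lefschetz model -/
theorem lef_faceReduction : lefModel.FaceReduction :=
  StubTree.faceReduction_holds lefModel lef_pohlmannSpan lef_qw8Sufficiency

/-- Lemma 8.1 holds in the Lefschetz model -/
theorem lef_lemma81 : lefModel.Lemma81 := StubTree.lemma81_holds lefModel lefModel_modelAxioms

/-- **`W_RK4` (rfwf Thm 1.3: the Weil lines of faces are algebraic) FAILS in the Lefschetz model** — witnessed by
the face `f7` of `ℚ(ζ₇)` (Galois, degree `6`). -/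
theorem not_w_rk4_lefModel : ¬ lefModel.W_RK4 := fun h =>
  not_weilFaceAlgebraic_f7_lefModel (h cyclo7 cyclo7_isGalois (by rw [cyclo7_finrank]) f7)

/-- **HEADLINE (separation for the top assembly `Assembly.COR_CM`).** `ModelAxioms` and BOTH reduction inputs
`PohlmannSpan`, `Qw8Sufficiency` of `Assembly.COR_CM` — hence `FaceReduction` and `Lemma81` — hold in one universe
in which `W_RK4`, COR-CM and the face realisation all fail. -/
theorem reductionInputs_not_sufficient :
    ∃ U : Universe, U.ModelAxioms ∧ U.PohlmannSpan ∧ U.Qw8Sufficiency ∧ U.FaceReduction ∧ U.Lemma81 ∧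
      ¬ U.W_RK4 ∧ ¬ U.HC_CM ∧ ¬ U.RealisationExistsFace :=
  ⟨lefModel, lefModel_modelAxioms, lef_pohlmannSpan, lef_qw8Sufficiency, lef_faceReduction, lef_lemma81,
    not_w_rk4_lefModel, not_hc_cm_lefModel, not_realisationExistsFace_lefModel⟩

/-- **COR-CM does not follow from the model facts and the two reduction inputs.** -/
theorem not_cor_cm_of_reductionInputs :
    ¬ ∀ U : Universe, U.ModelAxioms → U.PohlmannSpan → U.Qw8Sufficiency → U.HC_CM := fun h =>
  not_hc_cm_lefModel (h lefModel lefModel_modelAxioms lef_pohlmannSpan lef_qw8Sufficiency)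

/-- … nor does `W_RK4`. -/
theorem not_w_rk4_of_reductionInputs :
    ¬ ∀ U : Universe, U.ModelAxioms → U.PohlmannSpan → U.Qw8Sufficiency → U.W_RK4 := fun h =>
  not_w_rk4_lefModel (h lefModel lefModel_modelAxioms lef_pohlmannSpan lef_qw8Sufficiency)

end Toy

end HodgeCM

end
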